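import Literature.NumberTheory.Automorphic.KTypeGrowthOfHarishChandraMultiplicity  -- ★ p830845 (A-p06 (g24)): N5 `kTypeGrowth_of_harishChandraMultiplicity` (+ the LETTER V19 ★ p829390, KF2 ★ p828868)
import Literature.NumberTheory.Automorphic.HarishChandraMultiplicityOfFiltration    -- ★-to-be p831307 (A-p06 (g24)): N4 GLUE (over ★ N4a p831059, ★ N4b p831104)
import Literature.NumberTheory.Automorphic.UpqGKModulePFiltration                   -- ★ p831041 (A-p14 (g23)): N1 `upqPFiltration`, `exists_mem_upqPFiltration`, `finiteDimensional_upqPFiltration`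
import Literature.NumberTheory.Automorphic.UpqCasimirPPartKStable                   -- ★ p831010 (A-p06 (g24)): N2 (over N0 ★ p830646) — used by N3, imported for the hands
import Literature.NumberTheory.Automorphic.FlathLocalLemmas                         -- ★ `exists_irreducible_stable_le` (an irreducible `K`-stable `W₀` inside a finite-dim `K`-stable `Z`)
import Literature.NumberTheory.Automorphic.U21HarishChandraLevelBound               -- ★ p832477 (A-p14 (g23)): N3 `u21_levelBound` — CLOSES `stub_N3` (ED. 2)
import HarnessLib

/-!
# PAY-DOWN LINE for the letter V19 `IrreducibleUnitaryKTypeGrowth` at `U(2,1)`: `finrank E(τ) ≤ c · (dim τ)²` — ED. 2: ALL STUBS CLOSED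

Cell `hodgecm-mathlib`, F0∕P3, T1a arch line; crux `stmt-HodgeConjecture-24833` (H413); pen A-p06 (g24); LEAD F0P3b-p01 (g2) «= GO» 17:59:55Z, «PEN tonight»
18:45:09Z; desk F0P3b-plan (g10) registered ED. 1 (commit cdc6bbdbd5a1, one stub `stub_N3`).  **ED. 2 (this text): `stub_N3` CLOSED by ★ `u21_levelBound`
(A-p14 (g23), `U21HarishChandraLevelBound`) — NO `sorry` LEFT; the head `kTypeGrowth₂₁_holds` is a THEOREM (axioms TRIO); every statement of ED. 1 byte-unchanged.**

WHY THIS LINE.  Books row #91 is now V19 [Varadarajan1989 §5.4 Thm 19 = HC1954] (director s640); ★ C1′ p831233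
`archIntegratedOperatorTraceClass_forall_of_kTypeGrowthU21 (h19 : ‹KTypeGrowth₂₁ body›)` consumes EXACTLY this draft's head `KTypeGrowth₂₁` (V19 at
`(Fin 2, Fin 1)`), so `kTypeGrowth₂₁_holds` closes T1a's `stub_V19` re-typed to `KTypeGrowth₂₁` (ED. 9, desk) ⇒ #91 −1 outright.  HONEST: the general-`(p,q)`
letter is NOT paid by this rank-one road.

THE ROAD AND ITS STATE (all nodes but N3 are ★):
* N0 ★ p830646 `GKModulesDixmierSchur` — Casimir scalar on `H_K^∞` (Dixmier, no admissibility);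
* N1 ★ p831041 `UpqGKModulePFiltration` (A-p14 (g23)) — `F n := upqPFiltration dϖ W₀ n = Σ_{k≤n} 𝔭^k·W₀`, `K`-stable, finite-dim, exhaustive, symmetrised words;
* N2 ★ p831010 `UpqCasimirPPartKStable` — `Σ_s dϖ(x_s)²` preserves every `K`-stable subspace (`q·Sym^{n−2} ↦ 0` in `F n∕F (n−1)`);
* **N3 ★ (ED. 2) = `stub_N3 : LevelBound₂₁` PROVED** by ★ `u21_levelBound` (A-p14 (g23): «𝔰𝔩₂-strings inside V» — N3a `UpqComplexifiedAction` p831261, N3b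
  `UpqGKModuleBigradedLevels`, N3c `U21RootMonomials` p831696, N3d `Algebra/Lie/Sl2ExplicitStringTensor` p831889, N3e-1 `U21LevelStrings` p832119, N3e-2
  `U21WeightVectorsFiltrationBound` p832358, N3e-3 `U21HarishChandraLevelBound`; with ★ G2 p831571, ★ Schur p831510, ★ N4b p831104): the per-level multiplicity
  bound along `F` with its ORTHOGONAL complements `Q (m+1) = F (m+1) ⊓ (F m)ᗮ`, `dim Hom_K(τ, F 0) + Σ_{m<n} dim Hom_K(τ, Q (m+1)) = dim Hom_K(τ, F n) ≤ dim W₀ ≤ dim W₀ · dim τ`;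
* N4 ★ p831059 `IntertwiningMapExhaustion` + ★ p831104 `IntertwiningMapFiltrationTelescope` + GLUE ★-to-be p831307 `HarishChandraMultiplicityOfFiltration`;
* N5 ★ p830845 `KTypeGrowthOfHarishChandraMultiplicity` — `dim Hom_K(τ, H_K^∞) ≤ d₀·dim τ ⇒ dim E(τ) ≤ d₀·(dim τ)²` (KF2).
THIS FILE PROVES: `pFiltSubrep` (N1's `F n` as `Subrepresentation`s of ★ `harishChandraRepK`), `exists_irreducible_kStable` (an irreducible finite-dim `K`-stable
`W₀ ≠ ⊥` in `H_K^∞`: `K`-finiteness + ★ `exists_irreducible_stable_le`), **`hcModuleMultBound₂₁_of_levelBound : LevelBound₂₁ → HCModuleMultBound₂₁`**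
(N1 + GLUE), `stub_N3` (:= ★ `u21_levelBound`, ED. 2), `stub_multBound` (:= that ∘ `stub_N3`), `kTypeGrowth₂₁_of_multBound` (N5 by name), `kTypeGrowth₂₁_holds`
(head, axioms TRIO as of ED. 2).
HONEST LABEL: HC_CM is proved only modulo the 2 remaining named inputs (hLiu418, h413) — behind them the booked printed statements (incl. V19) + the MOD package —
until rung 0 closes; this draft pays nothing by itself.
-/

set_option autoImplicit false
set_option linter.dupNamespace false  -- the mandated `Summit.HodgeConjecture.HodgeConjecture.…` namespace (as every H413 Lines file)

noncomputable section

open Literature.NumberTheory.Automorphic Literature.RepresentationTheory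
open Literature.RepresentationTheory.KonnoKonno2007 Literature.RepresentationTheory.KonnoKonno2007.RealDualPair
open Literature.RepresentationTheory.BorelWallach2000
open scoped InnerProductSpace

namespace Summit.HodgeConjecture.HodgeConjecture.Cruxes.H413.F0T1aV19KTypeGrowthPaydown

/-! ## §1 The head (V19 at `U(2,1)`) and the open algebraic heart -/

/-- **V19 AT `U(2,1)`** — the body of ★ `IrreducibleUnitaryKTypeGrowth` with `α := Fin 2`, `β := Fin 1` (what the T1a closer ★
`archIntegratedOperatorTraceClass_of_nuclearOfKTypeGrowth` actually consumes). [cite: Varadarajan1989, §5.4 Thm. 19] -/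
def KTypeGrowth₂₁ : Prop :=
  ∀ (x : GKIrrClass (uFormGroup (Fin 2) (Fin 1)))
    (E : Type) [NormedAddCommGroup E] [InnerProductSpace ℂ E] [CompleteSpace E]
    (ϖ : ContRepresentation ℂ (uFormGroup (Fin 2) (Fin 1)).carrier E),
    IsUnitaryGlobalization (uFormGroup (Fin 2) (Fin 1)) x ϖ →
    ∃ c : ℝ, ∀ (W : Type) [AddCommGroup W] [Module ℂ W] [FiniteDimensional ℂ W]
      (τ : Representation ℂ (uFormGroup (Fin 2) (Fin 1)).maximalCompact W), τ.IsIrreducible →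
      FiniteDimensional ℂ (Representation.homRangeSum
          (ϖ.restrict (Subgroup.inclusion (uFormGroup (Fin 2) (Fin 1)).maximalCompact_le_carrier)).toRepresentation τ) ∧
        (Module.finrank ℂ (Representation.homRangeSum
            (ϖ.restrict (Subgroup.inclusion (uFormGroup (Fin 2) (Fin 1)).maximalCompact_le_carrier)).toRepresentation τ) : ℝ) ≤
          c * (Module.finrank ℂ W : ℝ) ^ 2

/-- The letter implies its `U(2,1)` instance (so the draft's head is WEAKER than V19, never stronger). [cite: Varadarajan1989, §5.4 Thm. 19] -/
theorem kTypeGrowth₂₁_of_letter (h : IrreducibleUnitaryKTypeGrowth) : KTypeGrowth₂₁ :=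
  fun x E _ _ _ ϖ hϖ => h (Fin 2) (Fin 1) x E ϖ hϖ

/-- **THE OPEN ALGEBRAIC HEART (N1–N4 folded): `K`-multiplicities of the Harish-Chandra module grow at most linearly** — for a unitary globalization `ϖ`
of an irreducible `(𝔤,K)`-class of `U(2,1)` there is `d₀ : ℕ` (the dimension of one `K`-type of `H_K^∞`) with `dim Hom_K(τ, H_K^∞) ≤ d₀ · dim τ` for every
irreducible finite-dimensional `K`-module `τ` (the `K`-action on `H_K^∞` being ★ `ContRepresentation.subRep` of `ϖ|_K`, KF2's currency).
[cite: Varadarajan1989, §5.4 Thm. 19] [cite: KnappVogan1995, Prop. 4.87] -/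
def HCModuleMultBound₂₁ : Prop :=
  ∀ (x : GKIrrClass (uFormGroup (Fin 2) (Fin 1)))
    (E : Type) [NormedAddCommGroup E] [InnerProductSpace ℂ E] [CompleteSpace E]
    (ϖ : ContRepresentation ℂ (uFormGroup (Fin 2) (Fin 1)).carrier E),
    IsUnitaryGlobalization (uFormGroup (Fin 2) (Fin 1)) x ϖ →
    ∃ d₀ : ℕ, ∀ (W : Type) [AddCommGroup W] [Module ℂ W] [FiniteDimensional ℂ W]
      (τ : Representation ℂ (uFormGroup (Fin 2) (Fin 1)).maximalCompact W), τ.IsIrreducible →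
      FiniteDimensional ℂ (τ.IntertwiningMap
          ((ϖ.restrict (Subgroup.inclusion (uFormGroup (Fin 2) (Fin 1)).maximalCompact_le_carrier)).subRep
            (harishChandraSpace (uFormGroup (Fin 2) (Fin 1)) ϖ) ((uFormGroup (Fin 2) (Fin 1)).restrict_mem_harishChandraSpace))) ∧
        Module.finrank ℂ (τ.IntertwiningMap
          ((ϖ.restrict (Subgroup.inclusion (uFormGroup (Fin 2) (Fin 1)).maximalCompact_le_carrier)).subRep
            (harishChandraSpace (uFormGroup (Fin 2) (Fin 1)) ϖ) ((uFormGroup (Fin 2) (Fin 1)).restrict_mem_harishChandraSpace))) ≤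
          d₀ * Module.finrank ℂ W

/-! ## §2 N1 packaged: the `𝔭`-filtration of `H_K^∞` as `K`-subrepresentations -/

/-- The `(𝔤, K)`-axioms of `H_K^∞` (★ `isGKModule_harishChandra_holds`). [cite: BorelWallach2000, 0 §2.5] -/
theorem isGKModule_hc {x : GKIrrClass (uFormGroup (Fin 2) (Fin 1))}
    {E : Type} [NormedAddCommGroup E] [InnerProductSpace ℂ E] [CompleteSpace E] {ϖ : ContRepresentation ℂ (uFormGroup (Fin 2) (Fin 1)).carrier E}
    (hϖ : IsUnitaryGlobalization (uFormGroup (Fin 2) (Fin 1)) x ϖ) :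
    IsGKModule (uFormGroup (Fin 2) (Fin 1)) (harishChandraRepK (uFormGroup (Fin 2) (Fin 1)) ϖ) (harishChandraRepLie (uFormGroup (Fin 2) (Fin 1)) ϖ hϖ.isStronglyContinuous) :=
  isGKModule_harishChandra_holds (uFormGroup (Fin 2) (Fin 1)) ϖ hϖ.isStronglyContinuous (harishChandraRepK (uFormGroup (Fin 2) (Fin 1)) ϖ)
    (fun _ _ => rfl) (isHarishChandraModuleOf_harishChandraRepLie (uFormGroup (Fin 2) (Fin 1)) ϖ hϖ.isStronglyContinuous)

/-- **N1's `F n` as a `K`-subrepresentation of `H_K^∞`**: `upqPFiltration dϖ W₀ n`, `K`-stable by ★ `apply_mem_upqPFiltration_of_K_stable`.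
[cite: Varadarajan1989, §5.3 (proof of Thm. 10)] -/
def pFiltSubrep {x : GKIrrClass (uFormGroup (Fin 2) (Fin 1))}
    {E : Type} [NormedAddCommGroup E] [InnerProductSpace ℂ E] [CompleteSpace E] {ϖ : ContRepresentation ℂ (uFormGroup (Fin 2) (Fin 1)).carrier E}
    (hϖ : IsUnitaryGlobalization (uFormGroup (Fin 2) (Fin 1)) x ϖ) (W₀ : Submodule ℂ (harishChandraSpace (uFormGroup (Fin 2) (Fin 1)) ϖ))
    (hW₀ : ∀ (k : (uFormGroup (Fin 2) (Fin 1)).maximalCompact), ∀ w ∈ W₀, harishChandraRepK (uFormGroup (Fin 2) (Fin 1)) ϖ k w ∈ W₀) (n : ℕ) :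
    Subrepresentation (harishChandraRepK (uFormGroup (Fin 2) (Fin 1)) ϖ) where
  toSubmodule := upqPFiltration (harishChandraRepLie (uFormGroup (Fin 2) (Fin 1)) ϖ hϖ.isStronglyContinuous) W₀ n
  apply_mem_toSubmodule := fun k _ hv => apply_mem_upqPFiltration_of_K_stable (harishChandraRepK (uFormGroup (Fin 2) (Fin 1)) ϖ) (isGKModule_hc hϖ) hW₀ n k hv

/-- `(pFiltSubrep hϖ W₀ hW₀ n).toSubmodule = upqPFiltration dϖ W₀ n`. [cite: Varadarajan1989, §5.3 (proof of Thm. 10)] -/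
theorem pFiltSubrep_toSubmodule {x : GKIrrClass (uFormGroup (Fin 2) (Fin 1))}
    {E : Type} [NormedAddCommGroup E] [InnerProductSpace ℂ E] [CompleteSpace E] {ϖ : ContRepresentation ℂ (uFormGroup (Fin 2) (Fin 1)).carrier E}
    (hϖ : IsUnitaryGlobalization (uFormGroup (Fin 2) (Fin 1)) x ϖ) (W₀ : Submodule ℂ (harishChandraSpace (uFormGroup (Fin 2) (Fin 1)) ϖ))
    (hW₀ : ∀ (k : (uFormGroup (Fin 2) (Fin 1)).maximalCompact), ∀ w ∈ W₀, harishChandraRepK (uFormGroup (Fin 2) (Fin 1)) ϖ k w ∈ W₀) (n : ℕ) :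
    (pFiltSubrep hϖ W₀ hW₀ n).toSubmodule = upqPFiltration (harishChandraRepLie (uFormGroup (Fin 2) (Fin 1)) ϖ hϖ.isStronglyContinuous) W₀ n :=
  rfl

/-- **An irreducible finite-dimensional `K`-stable `W₀ ≠ ⊥` exists in `H_K^∞`** (`H_K^∞ ≠ 0` for an irreducible class; every vector is `K`-finite; a
finite-dimensional `K`-stable `Z ≠ ⊥` contains an irreducible `K`-stable `W₀ ≠ ⊥`, ★ `exists_irreducible_stable_le`). [cite: KnappVogan1995, §I.3] -/
theorem exists_irreducible_kStable {x : GKIrrClass (uFormGroup (Fin 2) (Fin 1))}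
    {E : Type} [NormedAddCommGroup E] [InnerProductSpace ℂ E] [CompleteSpace E] {ϖ : ContRepresentation ℂ (uFormGroup (Fin 2) (Fin 1)).carrier E}
    (hϖ : IsUnitaryGlobalization (uFormGroup (Fin 2) (Fin 1)) x ϖ) :
    ∃ W₀ : Submodule ℂ (harishChandraSpace (uFormGroup (Fin 2) (Fin 1)) ϖ), FiniteDimensional ℂ W₀ ∧ W₀ ≠ ⊥ ∧
      (∀ (k : (uFormGroup (Fin 2) (Fin 1)).maximalCompact), ∀ w ∈ W₀, harishChandraRepK (uFormGroup (Fin 2) (Fin 1)) ϖ k w ∈ W₀) ∧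
      ∀ U : Submodule ℂ (harishChandraSpace (uFormGroup (Fin 2) (Fin 1)) ϖ), U ≤ W₀ →
        (∀ (k : (uFormGroup (Fin 2) (Fin 1)).maximalCompact), ∀ u ∈ U, harishChandraRepK (uFormGroup (Fin 2) (Fin 1)) ϖ k u ∈ U) → U = ⊥ ∨ U = W₀ := by
  have hV := isGKModule_hc hϖ
  have hirr := hϖ.isIrreducibleGK_harishChandra
  haveI := hirr.nontrivial
  obtain ⟨v, hv⟩ := exists_ne (0 : harishChandraSpace (uFormGroup (Fin 2) (Fin 1)) ϖ)
  -- `Z` := the span of the `K`-orbit of `v`: finite-dimensional, `K`-stable, `≠ ⊥`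
  let Z : Submodule ℂ (harishChandraSpace (uFormGroup (Fin 2) (Fin 1)) ϖ) := Submodule.span ℂ (Set.range fun k : (uFormGroup (Fin 2) (Fin 1)).maximalCompact => harishChandraRepK (uFormGroup (Fin 2) (Fin 1)) ϖ k v)
  haveI hZfd : FiniteDimensional ℂ Z := hV.kFinite v
  have hZK : ∀ (k : (uFormGroup (Fin 2) (Fin 1)).maximalCompact), ∀ z ∈ Z, harishChandraRepK (uFormGroup (Fin 2) (Fin 1)) ϖ k z ∈ Z := fun k z hz => GKTensor.kOrbitSpan_stable (uFormGroup (Fin 2) (Fin 1)) _ v k hz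
  have hvZ : v ∈ Z := IsGKModule.mem_span_orbit_self v
  have hZne : Z ⊓ ⊤ ≠ ⊥ := by
    rw [inf_top_eq]
    intro h
    exact hv ((Submodule.eq_bot_iff _).mp h v hvZ)
  haveI : Module.Finite ℂ ↥(Z ⊓ ⊤) := by rw [inf_top_eq]; infer_instance
  obtain ⟨W₀, hW₀Z, hW₀K, hW₀ne, hW₀irr⟩ := exists_irreducible_stable_le (σ := harishChandraRepK (uFormGroup (Fin 2) (Fin 1)) ϖ) ⊤ Z hZK hZne
    (fun Y _ _ hY => by rwa [inf_top_eq])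
  refine ⟨W₀, Submodule.finiteDimensional_of_le hW₀Z, ?_, hW₀K, hW₀irr⟩
  rwa [inf_top_eq] at hW₀ne

/-! ## §3 N3, the per-level multiplicity bound along the `𝔭`-filtration (the stub of ED. 1; CLOSED in ED. 2) -/

/-- **N3 SOCKET `LevelBound₂₁`** — for a unitary globalization `ϖ` of an irreducible class of `U(2,1)` and an irreducible finite-dimensional `K`-stable `W₀ ≠ ⊥`
in `H_K^∞`: there is `B : ℕ` such that for every irreducible finite-dimensional `K`-module `τ` on `W : Type` and every system `Q` of `K`-stable complements along
N1's filtration `F n = upqPFiltration dϖ W₀ n` (`F (m+1) = F m ⊔ Q (m+1)`, `F m ⊓ Q (m+1) = ⊥`, `Q (m+1) = F (m+1) ⊓ (F m)ᗮ` in the pre-Hilbert `H_K^∞`,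
`Q 0 = F 0`), `dim Hom_K(τ, F 0) + Σ_{m<n} dim Hom_K(τ, Q (m+1)) ≤ B · dim τ` for all `n`.  (N2 ★ p831010 makes `Q (m+1)` a `K`-quotient of the
harmonics `𝓗^{m+1} ⊗ W₀`; for `U(2,1)` these are multiplicity-free — A-p14 (g23)'s strings give even `B` independent of `τ`.)
[cite: Varadarajan1989, §5.4 Thm. 19] [cite: KnappVogan1995, Prop. 4.87] -/
def LevelBound₂₁ : Prop :=
  ∀ (x : GKIrrClass (uFormGroup (Fin 2) (Fin 1)))
    (E : Type) [NormedAddCommGroup E] [InnerProductSpace ℂ E] [CompleteSpace E]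
    (ϖ : ContRepresentation ℂ (uFormGroup (Fin 2) (Fin 1)).carrier E) (hϖ : IsUnitaryGlobalization (uFormGroup (Fin 2) (Fin 1)) x ϖ)
    (W₀ : Submodule ℂ (harishChandraSpace (uFormGroup (Fin 2) (Fin 1)) ϖ)) [FiniteDimensional ℂ W₀]
    (hW₀ : ∀ (k : (uFormGroup (Fin 2) (Fin 1)).maximalCompact), ∀ w ∈ W₀, harishChandraRepK (uFormGroup (Fin 2) (Fin 1)) ϖ k w ∈ W₀), W₀ ≠ ⊥ →
    (∀ U : Submodule ℂ (harishChandraSpace (uFormGroup (Fin 2) (Fin 1)) ϖ), U ≤ W₀ →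
      (∀ (k : (uFormGroup (Fin 2) (Fin 1)).maximalCompact), ∀ u ∈ U, harishChandraRepK (uFormGroup (Fin 2) (Fin 1)) ϖ k u ∈ U) → U = ⊥ ∨ U = W₀) →
    ∃ B : ℕ, ∀ (W : Type) [AddCommGroup W] [Module ℂ W] [FiniteDimensional ℂ W]
      (τ : Representation ℂ (uFormGroup (Fin 2) (Fin 1)).maximalCompact W), τ.IsIrreducible →
      ∀ Q : ℕ → Subrepresentation (harishChandraRepK (uFormGroup (Fin 2) (Fin 1)) ϖ),
        (∀ m, pFiltSubrep hϖ W₀ hW₀ (m + 1) = pFiltSubrep hϖ W₀ hW₀ m ⊔ Q (m + 1)) →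
        (∀ m, Disjoint (pFiltSubrep hϖ W₀ hW₀ m).toSubmodule (Q (m + 1)).toSubmodule) →
        (∀ m, (Q (m + 1)).toSubmodule = (pFiltSubrep hϖ W₀ hW₀ (m + 1)).toSubmodule ⊓ (pFiltSubrep hϖ W₀ hW₀ m).toSubmoduleᗮ) →
        Q 0 = pFiltSubrep hϖ W₀ hW₀ 0 →
        ∀ n, Module.finrank ℂ (Representation.IntertwiningMap τ (pFiltSubrep hϖ W₀ hW₀ 0).toRepresentation) +
          ∑ m ∈ Finset.range n, Module.finrank ℂ (Representation.IntertwiningMap τ (Q (m + 1)).toRepresentation) ≤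
            B * Module.finrank ℂ W

/-- **`stub_N3`** — CLOSED in ED. 2 by ★ `u21_levelBound` (A-p14 (g23), `𝔰𝔩₂`-strings inside `H_K^∞`; `B = dim W₀`), `pFiltSubrep` fed through its
abstract-filtration binder by `pFiltSubrep_toSubmodule`. [cite: Varadarajan1989, §5.4 Thm. 19] [cite: KnappVogan1995, §IV.6] -/
theorem stub_N3 : LevelBound₂₁ := by
  intro x E _ _ _ ϖ hϖ W₀ _ hW₀ hne hirr
  obtain ⟨B, hB⟩ := Literature.NumberTheory.Automorphic.u21_levelBound hϖ W₀ hW₀ hne hirr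
  exact ⟨B, fun W _ _ _ τ hτ Q h₁ h₂ h₃ h₄ n => hB W τ hτ (pFiltSubrep hϖ W₀ hW₀) (pFiltSubrep_toSubmodule hϖ W₀ hW₀) Q h₁ h₂ h₃ h₄ n⟩

/-! ## §4 ASSEMBLY (PROVED): `LevelBound₂₁ → HCModuleMultBound₂₁` by N1 + the N4 GLUE -/

/-- **N1 + N4: the per-level bound gives the linear multiplicity bound on `H_K^∞`.** [cite: Varadarajan1989, §5.4 Thm. 19] [cite: KnappVogan1995, §I.3] -/
theorem hcModuleMultBound₂₁_of_levelBound (h : LevelBound₂₁) : HCModuleMultBound₂₁ := by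
  intro x E _ _ _ ϖ hϖ
  obtain ⟨W₀, hW₀fd, hW₀ne, hW₀K, hW₀irr⟩ := exists_irreducible_kStable hϖ
  haveI := hW₀fd
  obtain ⟨B, hB⟩ := h x E ϖ hϖ W₀ hW₀K hW₀ne hW₀irr
  refine ⟨B, fun W _ _ _ τ hτ => ?_⟩
  -- N1: the chain is monotone, levelwise finite-dimensional and exhaustive
  haveI hfd : ∀ m, FiniteDimensional ℂ (pFiltSubrep hϖ W₀ hW₀K m).toSubmodule := fun m =>
    finiteDimensional_upqPFiltration W₀ m
  have hmono : ∀ m, pFiltSubrep hϖ W₀ hW₀K m ≤ pFiltSubrep hϖ W₀ hW₀K (m + 1) := fun m =>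
    show (pFiltSubrep hϖ W₀ hW₀K m).toSubmodule ≤ (pFiltSubrep hϖ W₀ hW₀K (m + 1)).toSubmodule from
      monotone_upqPFiltration _ W₀ (Nat.le_succ m)
  have hex : ∀ v : harishChandraSpace (uFormGroup (Fin 2) (Fin 1)) ϖ, ∃ n, v ∈ (pFiltSubrep hϖ W₀ hW₀K n).toSubmodule := fun v =>
    exists_mem_upqPFiltration (harishChandraRepK (uFormGroup (Fin 2) (Fin 1)) ϖ) (isGKModule_hc hϖ) hϖ.isIrreducibleGK_harishChandra hW₀K hW₀ne v
  -- N4 GLUE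
  exact finite_and_finrank_intertwiningMap_harishChandra_le_of_filtration (uFormGroup (Fin 2) (Fin 1)) hϖ.isUnitary (pFiltSubrep hϖ W₀ hW₀K) hmono hex τ
    (fun Q h1 h2 h3 h4 n => hB W τ hτ Q h1 h2 h3 h4 n)

/-- **`stub_multBound`** — the algebraic heart, PROVED (ED. 2: `stub_N3` closed). [cite: Varadarajan1989, §5.4 Thm. 19] -/
theorem stub_multBound : HCModuleMultBound₂₁ :=
  hcModuleMultBound₂₁_of_levelBound stub_N3

/-! ## §5 N5 (★ by name) and the head -/

/-- **N5**: ★ `kTypeGrowth_of_harishChandraMultiplicity`. [cite: Varadarajan1989, §5.4 Thm. 19] -/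
theorem kTypeGrowth₂₁_of_multBound (h : HCModuleMultBound₂₁) : KTypeGrowth₂₁ := by
  intro x E _ _ _ ϖ hϖ
  obtain ⟨d₀, hd⟩ := h x E ϖ hϖ
  exact ⟨(d₀ : ℝ), fun W _ _ _ τ hτ => kTypeGrowth_of_harishChandraMultiplicity hϖ hd W τ hτ⟩

/-- **THE HEAD — V19 at `U(2,1)` is a THEOREM as of ED. 2** (axioms TRIO); plugs into ★ C1′ p831233 by `exact` (T1a ED. 9: `stub_V19 := kTypeGrowth₂₁_holds`). [cite: Varadarajan1989, §5.4 Thm. 19] -/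
theorem kTypeGrowth₂₁_holds : KTypeGrowth₂₁ :=
  kTypeGrowth₂₁_of_multBound stub_multBound

end Summit.HodgeConjecture.HodgeConjecture.Cruxes.H413.F0T1aV19KTypeGrowthPaydown

end
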